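import Literature.Computability.Complexity.NSubexp
import Literature.Computability.Complexity.Reductions
import HarnessLib

/-!
# `NSUBEXP` is closed downwards under Karp reductions (named fact) and its corollaries

Toolkit statement for the tree's `NSUBEXP = ⋂_{r>0} NTIME(2^{⌊n^{1/r}⌋})` (`NSubexp.lean`,
Kabanets–Impagliazzo 2003, §2.1) over the verifier-form `NTIME` (`Nondeterministic.lean`):

* `NSUBEXP_of_karpReducible` — **named fact**: `L ≤ₚ L' → L' ∈ NSUBEXP → L ∈ NSUBEXP`.
  This is the form in which "polynomial-time many-one reducible to ACIT" (Kabanets–Impagliazzo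
  2003, Lemma 11) is combined with "ACIT ∈ NSUBEXP" in the proof of their Cor. 12 (p. 358):
  a polynomial blow-up `m = |f x| ≤ A·|x|^d + A` of the input keeps a subexponential bound
  subexponential, `2^{⌊m^{1/(2dr)}⌋} ≤ 2^K · 2^{⌊|x|^{1/r}⌋}` (the exponent bookkeeping is the
  tree's `PolyExistsNTIME.exists_nthRoot_poly_le`, `PolyExistsNTIMEArith.lean`), so for the member
  `r` of the intersection one computes `f x` and runs the member `2dr` of the verifiers of `L'`.
  In the tree's one-constant verifier form of `NTIME` the new verifier must moreover cut
  over-long certificates at exactly the admissible length `c · 2^{⌊m^{1/(2dr)}⌋} + c` of the given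
  verifier, reading the discarded part two symbols per step (`TruncMapMachine.lean`), which needs
  that number in unary — the same clock construction as for `polyExists_NSUBEXP_subset_NSUBEXP`
  (`AaronsonVanMelkebeek2011.lean`); named fact, discharged by that machine construction in
  `NSubexpKarpProofs.lean` (`NSUBEXP_of_karpReducible_holds`).
* proved corollaries: the preimage form `preimage_mem_NSUBEXP_of_mem_FP` and the intersection of
  the two closures used by Kabanets–Impagliazzo's Cor. 12, `mem_NSUBEXP_of_polyExists_preimage`
  (`∃`-projection of an `FP`-preimage of an `NSUBEXP` language is `NSUBEXP`, from the two facts).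

## References

* V. Kabanets, R. Impagliazzo, *Derandomizing polynomial identity tests means proving circuit
  lower bounds*, STOC 2003, §2.1 (p. 357: `NSUBEXP = ∩_{ε>0} NTIME(2^{n^ε})`), Lemma 11 and
  Cor. 12 with its proof (p. 358).
* S. Aaronson, D. van Melkebeek, *On circuit lower bounds from derandomization*, Theory of
  Computing 7 (2011), proof of Lemma 3.1.
* S. Arora, B. Barak, *Computational Complexity: A Modern Approach*, CUP 2009, Def. 2.7,
  Thm. 2.8 (closure under `≤ₚ`), Def. 2.1 / §2.1.2 (verifier form of nondeterministic time).
-/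

namespace Literature.Computability.Complexity

open _root_.Computability
open scoped Notation

/-- **`NSUBEXP` is closed downwards under polynomial-time many-one reductions** (named fact):
if `L ≤ₚ L'` and `L' ∈ ⋂_{ε>0} NTIME(2^{n^ε})` then `L ∈ ⋂_{ε>0} NTIME(2^{n^ε})`. Used (implicitly)
by Kabanets–Impagliazzo 2003 in the proof of Cor. 12 (p. 358), where Lemma 11 ("ACP … is
polynomial-time many-one reducible to ACIT") is combined with the hypothesis "ACIT over `ℤ` is in
NSUBEXP" to get "testing whether `C` is indeed computing Perm can be done in NSUBEXP". Mechanism: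
for `|f x| ≤ A |x|^d + A` one has `⌊(A n^d + A)^{1/(2dr)}⌋ ≤ ⌊n^{1/r}⌋ + K`
(`PolyExistsNTIME.exists_nthRoot_poly_le`), so the member `r` of the intersection for `L` is
served by `f` followed by the member `2dr` of the verifiers of `L'`, with certificates cut at the
admissible length of the latter (cf. `TruncMapMachine.lean`). Here `L ≤ₚ L'` is the tree's
`PolyTimeKarpReducible` (`Reductions.lean`: some `f ∈ FP` with `x ∈ L ↔ f x ∈ L'`) and
`NSUBEXP = ⋂_{r>0} NTIME(2^{⌊n^{1/r}⌋})` (`NSubexp.lean`).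
[cite: KabanetsImpagliazzo2003, §2.1 (p. 357) and proof of Cor. 12 (p. 358)] -/
def NSUBEXP_of_karpReducible : Prop :=
  ∀ ⦃L L' : Language Bool⦄, L ≤ₚ L' → L' ∈ NSUBEXP → L ∈ NSUBEXP

/-- Preimage form of `NSUBEXP_of_karpReducible`: for `f ∈ FP` and `L' ∈ NSUBEXP` the language
`{x | f x ∈ L'}` is in `NSUBEXP` (it reduces to `L'` by `f` itself).
[cite: KabanetsImpagliazzo2003, proof of Cor. 12 (p. 358)] -/
theorem preimage_mem_NSUBEXP_of_mem_FP (h : NSUBEXP_of_karpReducible) {f : List Bool → List Bool}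
    (hf : f ∈ FP) {L' : Language Bool} (hL' : L' ∈ NSUBEXP) : {x | f x ∈ L'} ∈ NSUBEXP :=
  h ⟨f, hf, fun _ => Iff.rfl⟩ hL'

/-- **Guess-and-reduce into `NSUBEXP`** (from the two closure facts): if `L' ∈ NSUBEXP`,
`f ∈ FP`, and `x ∈ L ↔ ∃ y, |y| ≤ p(|x|) ∧ f ⟨x, y⟩ ∈ L'` (a polynomial-time *nondeterministic*
many-one reduction of `L` to `L'`: guess `y`, map, ask once), then `L ∈ NSUBEXP`. This is the
shape of Kabanets–Impagliazzo 2003, proof of Cor. 12 (p. 358): "nondeterministically guess a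
poly(n)-size arithmetic circuit `C` … testing whether `C` is indeed computing Perm can be done in
NSUBEXP by Lemma 11". Assembled from `NSUBEXP_of_karpReducible` (the preimage `{w | f w ∈ L'}` is
in `NSUBEXP`) and `polyExists_NSUBEXP_subset_NSUBEXP` (`AaronsonVanMelkebeek2011.lean`: one
polynomially bounded `∃` in front of an `NSUBEXP` predicate).
[cite: KabanetsImpagliazzo2003, proof of Cor. 12 (p. 358)] -/
theorem mem_NSUBEXP_of_polyExists_preimage (hK : NSUBEXP_of_karpReducible)
    (hE : polyExists NSUBEXP ⊆ NSUBEXP) {L L' : Language Bool} {f : List Bool → List Bool}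
    (hf : f ∈ FP) (hL' : L' ∈ NSUBEXP) (p : Polynomial ℕ)
    (hL : ∀ x : List Bool, x ∈ L ↔ ∃ y : List Bool, y.length ≤ p.eval x.length ∧ f (boolPair x y) ∈ L') :
    L ∈ NSUBEXP :=
  hE ⟨{w | f w ∈ L'}, preimage_mem_NSUBEXP_of_mem_FP hK hf hL', p, hL⟩

end Literature.Computability.Complexity
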